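import Summits.QuantumAdvantage.QuantumAdvantage.Theorems.WhiteBoxWalkWbwObfuscatedGluedTreesClearReduction
import Summits.QuantumAdvantage.QuantumAdvantage.Theorems.WbwObfuscatedGluedTreesKowResParityFP
import Summits.QuantumAdvantage.QuantumAdvantage.Theorems.WbwObfuscatedGluedTreesKowResDiagonalBit
import Summits.QuantumAdvantage.QuantumAdvantage.Theorems.WbwObfuscatedGluedTreesKowResFPEnumeration
import Summits.QuantumAdvantage.QuantumAdvantage.Theorems.WbwObfuscatedGluedTreesKowResCoinSchedule
import Summits.QuantumAdvantage.QuantumAdvantage.Theorems.WbwObfuscatedGluedTreesKowResHalfCoin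

/-!
# Line `knowledge-of-walk-split`, STAGE 4 — AUDIT OF THE RESIDUAL: the `∀ O` residuals of stages 2–3 are inconsistent
# with the route's premise; the `∃`-form `ResidualExists` gives `WbwEngine`
# (crux `WbwObfuscatedGluedTrees`, stmt-QuantumAdvantage-2340, route WhiteBoxWalk)

Lead prover-line-stmt-QuantumAdvantage-2340-c3-0 (2026-08-17), continuing the line of leads -0 / -1 / c2 (stages 1–3
CLOSED: `knowledgeTransfer_holds` p92709, `generatorTransfer_holds` / `typedCrux_holds` p100064,
`clearReduction_holds` / `typedCruxClear_holds` p137178).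

## What stage 4 proves (`residualAudit_holds : ResidualAudit`, composition `WbwObfuscatedGluedTrees_of` fed by five registered stubs,
## all LANDED: `KowResFPEnumeration` p138542, `KowResDiagonalBit` p138525, `KowResHalfCoin` p138648, `KowResCoinSchedule` p138547,
## `KowResParityFP` p138336)

Stages 2–3 hand the planner, next to the PROVED typed crux `TypedCruxClear`, a residual to file:
`ResidualConjectureClear` (and the stronger `ResidualConjecture`).  Both quantify
"`∀ O, IsSubexpIO ε ppolyCircuits O → … → ∃ D, GenAdmissible D O P ∧ … ∧ FPData D.params O P ∧ …`".
In the tree's model an obfuscator's coin budget `O.coinLen : ℕ → ℕ` is only polynomially BOUNDED (an arbitrary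
function: `CircuitObfuscator.IsEfficient` = `RandAlg.IsPolyTime`; Disproof.lean §7 (T8)), whereas

* `GenAdmissible` (8) pins the datum's coin schedule: `D.c n = O.coins (ς (t n)) (Γ (t n) K)` eventually, and
* `FPData.coinLen` asks that very schedule to be `FP` (`CodeFP unE unE`).

For every sub-exp iO `O₀` and every bit sequence `b`, the COIN-HALVING obfuscator
`⟨fun κ C r => O₀.obf κ C (r.take (|r| / 2)), fun m => 2 · O₀.coinLen m + b m⟩` has the same obfuscation law, hence is
again a sub-exp iO (`stub_halfCoin`, cf. `Negative/CoinPadding.lean`); its coin demand along the datum is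
`2 · O₀.coinLen (m n) + b (m n)` for an `FP`, unbounded input-length schedule `m` (`stub_coinSchedule`), so its parity
`b ∘ m` would be `FP` (`stub_parityFP`).  Choosing `b` DIAGONAL against the countable family of `FP` schedules
(`stub_fpEnumeration`: every `FP` string function is a clocked universal simulation `extFn e Q`; `stub_diagonalBit`:
pure diagonal lemma) makes this impossible for EVERY datum.  Hence

* `residualConjectureClear_inconsistent : CryptoPremise → ¬ ResidualConjectureClear` and
  `residualConjecture_inconsistent : CryptoPremise → ¬ ResidualConjecture`, where `CryptoPremise` is VERBATIM the
  antecedent `H` of the route decl `WbwEngine` (`wbwEngine_iff : WbwEngine ↔ (CryptoPremise → WbwThesis)`, `Iff.rfl`):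
  the residual AS TYPED is refuted modulo the route's own premise, and `wbwEngine_of_residualConjectureClear` /
  `wbwEngine_of_residualConjecture'` are vacuous (`WbwEngine` holds trivially when `¬ H`);
* the `∃`-form residual `ResidualExists` (existential in `O, P, D` — immune to the T8 pathology, since the witnessing obfuscator
  may be one whose coin schedule along its datum is computable; crux-grade, never asserted) and
  `wbwEngine_of_residualExists : ResidualExists → WbwEngine` (unconditional; by `generatorClearTransfer_holds`,
  `FPData.polyTimeComputable_gen`, `exists_poly_length_ans`).

Typing request carried forward (fourth): signature := `…Generator.TypedCruxClear` (PROVED, `typedCruxClear_holds`);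
residual item := `…Generator.Residual.ResidualExists` (this file), NOT the `∀ O` forms.

## Disproof.lean (cycles 1–4) honoured

No `_false_without_` theorem exists.  §5: no answer-free terminal world is claimed.  §7 (T8) "gen ∈ FP needs a
COMPUTABLE coin budget" is exactly what this stage formalises at the level of the residual statement.
-/

set_option linter.dupNamespace false

noncomputable section

namespace Summit.QuantumAdvantage.QuantumAdvantage.Cruxes.WbwObfuscatedGluedTrees.KnowledgeOfWalkSplit.Generator.Residual

open Literature.Computability.Cryptography Literature.Computability.Complexity Filter Asymptotics
open Literature.Computability.Cryptography.ObfuscatedGluedTrees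
open Literature.Computability.QuantumComplexity
open Literature.Computability.Complexity.CodeFP (unE bitE pairE strE)
open Summit.QuantumAdvantage.QuantumAdvantage.Theorems.WbwObfuscatedGluedTrees.Negative (ClauseC)
open Summit.QuantumAdvantage.QuantumAdvantage.Theorems.WbwObfuscatedGluedTrees.KnowledgeOfWalk.Generator
open Summit.QuantumAdvantage.QuantumAdvantage.Cruxes.WbwObfuscatedGluedTrees.KnowledgeOfWalkSplit.Generator
open Summit.QuantumAdvantage.QuantumAdvantage.Theses.WhiteBoxWalk (WbwEngine WbwThesis)

/-! ## §0 The route's premise, verbatim -/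

/-- **The standing cryptographic premise `H` of the route** — VERBATIM the antecedent of the route decl `WbwEngine`
(BPR15 §5.1 ingredients at one exponent `ε ∈ (0,1)`: a sub-exponentially secure iO for `P/poly`, a sub-exponentially
secure length-preserving puncturable PRF, an injective one-way function). A hypothesis of the route, never a fact. -/
def CryptoPremise : Prop :=
  ∃ ε : ℝ, 0 < ε ∧ ε < 1 ∧ SubexpIOExist ε ∧
    TDSecurePuncturablePRFExist (fun κ => (2 : ℝ) ^ ((κ : ℝ) ^ ε)) (fun κ => (2 : ℝ) ^ (-((κ : ℝ) ^ ε))) id id ∧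
    ∃ f : List Bool → List Bool, IsOneWay f ∧ Function.Injective f

/-- `WbwEngine` IS `CryptoPremise → WbwThesis` (definitionally). -/
theorem wbwEngine_iff : WbwEngine ↔ (CryptoPremise → WbwThesis) := Iff.rfl

/-! ## §1 The five stubs (all LANDED as their own files; imported above, used BY NAME in `residualAudit_holds`)

* `stub_fpEnumeration` (M; p138542 `KowResFPEnumeration`) — `FP` is enumerable: every polynomial-time string function is the
  clocked universal simulation `FPExtension.extFn e Q` of some machine code `e` with some polynomial budget `Q`
  (`ClockedUS.sim`); codes and ℕ-polynomials are countable, so one sequence lists all of `FP`.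
* `stub_diagonalBit` (S/M; p138525 `KowResDiagonalBit`) — the diagonal bit sequence: against countably many ℕ-valued
  schedules `ms i` and countably many Boolean sequences `gs j` there is ONE `b : ℕ → Bool` such that, for every schedule
  unbounded along a subsequence, `b ∘ ms i` differs from every `gs j` beyond every `k`.
* `stub_halfCoin` (M; p138648 `KowResHalfCoin`) — coin halving preserves sub-exponential iO security (any class, any `ε`,
  any extra-bit sequence `b`): the obfuscator reading only the first half of its `2 · coinLen + b` coins has the SAME
  obfuscation law, hence the same functionality, slowdown and `(t,δ)`-security, and is efficient when `O` is.  Twin of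
  `Negative.CoinPad.isSubexpIO_padCoin`.
* `stub_coinSchedule` (M; p138547 `KowResCoinSchedule`) — the coin schedule of a `GenAdmissible` FP datum is the
  obfuscator's budget `O.coinLen ∘ m` eventually, for the FP, unbounded input-length schedule
  `m n := |encodeInput (ς (t n), ⟨2N, Γ (t n) 0^{4 t n}⟩)|`.
* `stub_parityFP` (S; p138336 `KowResParityFP`) — the parity of an `FP` unary schedule is an `FP` bit.
-/

/-! ### Name-keyed aliases of the five statements (hypotheses of the composition) -/
namespace Registered

/-- Statement of `stub_fpEnumeration`. -/
abbrev stub_fpEnumeration : Prop :=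
  ∃ seq : ℕ → (List Bool → List Bool), ∀ F : List Bool → List Bool, F ∈ FP → ∃ i, seq i = F
/-- Statement of `stub_diagonalBit`. -/
abbrev stub_diagonalBit : Prop :=
  ∀ (ms : ℕ → ℕ → ℕ) (gs : ℕ → ℕ → Bool), ∃ b : ℕ → Bool,
    ∀ i, (∀ B k : ℕ, ∃ n, k < n ∧ B < ms i n) → ∀ j k : ℕ, ∃ n, k < n ∧ b (ms i n) ≠ gs j n
/-- Statement of `stub_halfCoin`. -/
abbrev stub_halfCoin : Prop :=
  ∀ (ε : ℝ) (𝒞 : ℕ → Set SizedCircuit) (O : CircuitObfuscator) (b : ℕ → Bool), IsSubexpIO ε 𝒞 O →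
    IsSubexpIO ε 𝒞 (⟨fun κ {_} C r => O.obf κ C (r.take (r.length / 2)),
      fun m => 2 * O.coinLen m + (b m).toNat⟩ : CircuitObfuscator)
/-- Statement of `stub_coinSchedule`. -/
abbrev stub_coinSchedule : Prop :=
  ∀ (D : MasterData) (O : CircuitObfuscator) (P : PuncturablePRFScheme),
    GenAdmissible D O P → FPData D.params O P →
    ∃ m : ℕ → ℕ, CodeFP unE unE m ∧ (∀ B k : ℕ, ∃ n, k < n ∧ B < m n) ∧
      ∃ n₀ : ℕ, ∀ n, n₀ ≤ n → D.c n = O.coinLen (m n)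
/-- Statement of `stub_parityFP`. -/
abbrev stub_parityFP : Prop :=
  ∀ c : ℕ → ℕ, CodeFP unE unE c → CodeFP unE bitE (fun n => decide (c n % 2 = 1))

end Registered

/-! ## §2 The positive half: the `∃`-form residual and the route's engine from it (no stubs) -/

/-- **`ResidualExists` — the residual conjecture of the route after stage 4, in existential form (not refuted by the T8
argument of §3, unlike the `∀ O` forms).**
At every exponent `ε ∈ (0,1)` at which the BPR15 §5.1 primitives exist, SOME sub-exponentially secure iO `O`, SOME
PRF scheme `P` and SOME `GenAdmissible` master datum `D` carry `ClearHardness` (white-box EXIT-finding hardness in the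
clear for one admissible presentation — the crux's open core), the generator's polynomial-time data `FPData` (so the
coin schedule of THAT `O` along THAT datum is computable — automatic in print, a choice here) and clause (Q) for
`(gen D.params O P, ans D.params O P)`.  Crux-grade; NEVER asserted here.  This — not the `∀ O` forms
`ResidualConjecture` / `ResidualConjectureClear`, refuted below modulo the route's premise — is the statement to file. -/
def ResidualExists : Prop :=
  ∀ ε : ℝ, 0 < ε → ε < 1 → SubexpIOExist ε →
    TDSecurePuncturablePRFExist (fun κ => (2 : ℝ) ^ ((κ : ℝ) ^ ε)) (fun κ => (2 : ℝ) ^ (-((κ : ℝ) ^ ε))) id id →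
    (∃ f : List Bool → List Bool, IsOneWay f ∧ Function.Injective f) →
    ∃ (O : CircuitObfuscator) (P : PuncturablePRFScheme) (D : MasterData),
      IsSubexpIO ε ppolyCircuits O ∧ GenAdmissible D O P ∧ ClearHardness D O P ∧ FPData D.params O P ∧
      ∃ F : QCircuitFamily cliffordT, F.IsOracleFree ∧ F.IsUniform ∧
        ∀ s, 2 / 3 ≤ F.kernelProb 0 (gen D.params O P s) {y | ans D.params O P s <+: y}

/-- **`ResidualExists → WbwEngine`** (unconditional): the witness of `WbwThesis` is `(gen D.params O P, ans D.params O P)`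
— `gen ∈ FP` by `FPData.polyTimeComputable_gen`, `|ans s| = X.eval |gen s|` by `exists_poly_length_ans`, clause (Q) as
given, clause (C) by stage 3's `generatorClearTransfer_holds` from `GenAdmissible ∧ ClearHardness`. -/
theorem wbwEngine_of_residualExists (h : ResidualExists) : WbwEngine := by
  rintro ⟨ε, hε, hε1, hIO, hPRF, hf⟩
  obtain ⟨O, P, D, hO, hadm, hCH, hFP, F, hfree, hU, hQ⟩ := h ε hε hε1 hIO hPRF hf
  exact ⟨gen D.params O P, ans D.params O P, hFP.polyTimeComputable_gen, exists_poly_length_ans _ _ _,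
    ⟨F, hfree, hU, hQ⟩, clauseC_of_clearHardness generatorClearTransfer_holds D hε hO P hadm hCH⟩

/-- The `∀ O` residual of stage 3 implies the `∃`-form whenever its quantifier prefix is inhabited (which `CryptoPremise`
provides at its own exponent): `ResidualExists` is the WEAKER statement. -/
theorem residualExists_of_residualConjectureClear (h : ResidualConjectureClear) : ResidualExists := by
  intro ε hε hε1 hIO hPRF hf
  obtain ⟨O, hO⟩ := hIO
  obtain ⟨P, hPi, hPo, hP⟩ := hPRF
  obtain ⟨f, hfow, hfinj⟩ := hf
  obtain ⟨D, hadm, hCH, hFP, hQ⟩ := h ε hε hε1 O hO P hPi hPo hP f hfow hfinj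
  exact ⟨O, P, D, hO, hadm, hCH, hFP, hQ⟩

/-! ## §3 The negative half: the `∀ O` residuals are inconsistent with `CryptoPremise` -/

/-- From an enumeration of `FP`: every `FP` unary schedule is a length-of-output row. -/
theorem exists_row_of_codeFP_unE {seq : ℕ → (List Bool → List Bool)}
    (hseq : ∀ F : List Bool → List Bool, F ∈ FP → ∃ i, seq i = F) {m : ℕ → ℕ} (hm : CodeFP unE unE m) :
    ∃ i, (fun n => (seq i (unE n)).length) = m := by
  obtain ⟨F, hF, hFm⟩ := hm
  obtain ⟨i, rfl⟩ := hseq F hF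
  exact ⟨i, funext fun n => by rw [hFm, CodeFP.length_unE]⟩

/-- From an enumeration of `FP`: every `FP` bit sequence is a "`= [true]`" row. -/
theorem exists_row_of_codeFP_bitE {seq : ℕ → (List Bool → List Bool)}
    (hseq : ∀ F : List Bool → List Bool, F ∈ FP → ∃ i, seq i = F) {g : ℕ → Bool} (hg : CodeFP unE bitE g) :
    ∃ j, (fun n => decide (seq j (unE n) = [true])) = g := by
  obtain ⟨F, hF, hFg⟩ := hg
  obtain ⟨j, rfl⟩ := hseq F hF
  refine ⟨j, funext fun n => ?_⟩
  rw [hFg]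
  cases g n <;> simp [CodeFP.bitE]

/-- Parity of the halved coin budget: `(2a + b) % 2 = 1 ↔ b = true`. -/
theorem decide_two_mul_add_toNat_mod_two (a : ℕ) (b : Bool) :
    decide ((2 * a + b.toNat) % 2 = 1) = b := by
  cases b <;> simp [Nat.add_mod]

/-- **The `∀ O` residual of stage 3 is inconsistent with the route's premise** (from the five registered stubs). -/
theorem residualConjectureClear_inconsistent_of (h₁ : Registered.stub_fpEnumeration)
    (h₂ : Registered.stub_diagonalBit) (h₃ : Registered.stub_halfCoin) (h₄ : Registered.stub_coinSchedule)
    (h₅ : Registered.stub_parityFP) : CryptoPremise → ¬ ResidualConjectureClear := by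
  rintro ⟨ε, hε, hε1, ⟨O₀, hO₀⟩, ⟨P, hPi, hPo, hP⟩, ⟨f, hfow, hfinj⟩⟩ hRC
  -- the enumeration of FP and the diagonal bit sequence against its unary / bit rows
  obtain ⟨seq, hseq⟩ := h₁
  obtain ⟨b, hb⟩ := h₂ (fun i n => (seq i (unE n)).length) (fun j n => decide (seq j (unE n) = [true]))
  -- the coin-halving obfuscator with the diagonal extra bit is again a sub-exp iO
  have hO₁io := h₃ ε ppolyCircuits O₀ b hO₀
  -- the residual hands us an admissible FP datum for it
  obtain ⟨D, hadm, -, hFP, -⟩ := hRC ε hε hε1 _ hO₁io P hPi hPo hP f hfow hfinj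
  -- its coin schedule is `O₁.coinLen ∘ m` eventually, `m` FP and unbounded
  obtain ⟨m, hmFP, hmU, n₀, hc⟩ := h₄ D _ P hadm hFP
  -- so the parity of `D.c`, an FP bit, is `b ∘ m` eventually
  have hcFP : CodeFP unE unE D.c := hFP.coinLen
  have hpar : CodeFP unE bitE (fun n => decide (D.c n % 2 = 1)) := h₅ D.c hcFP
  obtain ⟨i, hi⟩ := exists_row_of_codeFP_unE hseq hmFP
  obtain ⟨j, hj⟩ := exists_row_of_codeFP_bitE hseq hpar
  have hmU' : ∀ B k : ℕ, ∃ n, k < n ∧ B < (seq i (unE n)).length := fun B k => by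
    obtain ⟨n, h1, h2⟩ := hmU B k
    exact ⟨n, h1, by rw [congrFun hi n]; exact h2⟩
  obtain ⟨n, hn, hne⟩ := hb i hmU' j n₀
  apply hne
  rw [congrFun hi n, congrFun hj n, hc n hn.le]
  exact (decide_two_mul_add_toNat_mod_two _ _).symm

/-- **Where the `∀ O` residual breaks: at `FPData`, not at admissibility.** For the diagonal coin-halving obfuscator of the
proof above (indeed for EVERY coin-halved sub-exp iO and every `(t,δ)`-secure PRF scheme) a `GenAdmissible` master datum of
unbounded depth EXISTS (stage 3's `exists_genAdmissible`, which never asks the coin schedule to be computable) — so what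
`ResidualConjectureClear` cannot supply for it is exactly the `FPData` conjunct (T8), as the proof shows. -/
theorem exists_genAdmissible_halfCoin (h₃ : Registered.stub_halfCoin) {ε : ℝ} {O : CircuitObfuscator}
    (hO : IsSubexpIO ε ppolyCircuits O) (b : ℕ → Bool) {P : PuncturablePRFScheme} {t δ : ℕ → ℝ}
    (hP : IsTDSecurePuncturablePRF P t δ) :
    ∃ D : MasterData,
      GenAdmissible D (⟨fun κ {_} C r => O.obf κ C (r.take (r.length / 2)),
        fun m => 2 * O.coinLen m + (b m).toNat⟩ : CircuitObfuscator) P ∧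
      ∀ B : ℕ, ∃ n₀ : ℕ, ∀ n, n₀ ≤ n → B ≤ D.δ (D.t n) := by
  obtain ⟨D, hadm, -, hdepth⟩ := Clear.typedCruxClear_antecedent_inhabited (h₃ ε ppolyCircuits O b hO) hP
  exact ⟨D, hadm, hdepth⟩

/-! ## §4 The target of stage 4 and its composition BY NAME -/

/-- **Stage-4 target: the audit of the residual.** (i) the stage-3 residual `ResidualConjectureClear` and (ii) the
stage-2 residual `ResidualConjecture` are each inconsistent with the route's premise `CryptoPremise` (= the antecedent
of `WbwEngine`); (iii) the `∃`-form `ResidualExists` gives `WbwEngine`. -/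
def ResidualAudit : Prop :=
  (CryptoPremise → ¬ ResidualConjectureClear) ∧ (CryptoPremise → ¬ ResidualConjecture) ∧
    (ResidualExists → WbwEngine)

/-- **Composition: the five registered stubs give the stage-4 target BY NAME.** -/
theorem WbwObfuscatedGluedTrees_of (h₁ : Registered.stub_fpEnumeration) (h₂ : Registered.stub_diagonalBit)
    (h₃ : Registered.stub_halfCoin) (h₄ : Registered.stub_coinSchedule) (h₅ : Registered.stub_parityFP) :
    ResidualAudit :=
  ⟨residualConjectureClear_inconsistent_of h₁ h₂ h₃ h₄ h₅,
    fun hH hR => residualConjectureClear_inconsistent_of h₁ h₂ h₃ h₄ h₅ hH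
      (residualConjectureClear_of_residualConjecture hR),
    wbwEngine_of_residualExists⟩

/-- **The stage-4 target holds**: the composition fed with the five LANDED stubs (§1) by name. -/
theorem residualAudit_holds : ResidualAudit :=
  WbwObfuscatedGluedTrees_of
    Summit.QuantumAdvantage.QuantumAdvantage.Theorems.WbwObfuscatedGluedTrees.KnowledgeOfWalk.Residual.stub_fpEnumeration
    Summit.QuantumAdvantage.QuantumAdvantage.Theorems.WbwObfuscatedGluedTrees.KnowledgeOfWalk.Residual.stub_diagonalBit
    Summit.QuantumAdvantage.QuantumAdvantage.Theorems.WbwObfuscatedGluedTrees.KnowledgeOfWalk.Residual.stub_halfCoin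
    Summit.QuantumAdvantage.QuantumAdvantage.Theorems.WbwObfuscatedGluedTrees.KnowledgeOfWalk.Residual.stub_coinSchedule
    Summit.QuantumAdvantage.QuantumAdvantage.Theorems.WbwObfuscatedGluedTrees.KnowledgeOfWalk.Residual.stub_parityFP

/-- **Corollary (i)**: `CryptoPremise → ¬ ResidualConjectureClear`. -/
theorem residualConjectureClear_inconsistent : CryptoPremise → ¬ ResidualConjectureClear := residualAudit_holds.1

/-- **Corollary (ii)**: `CryptoPremise → ¬ ResidualConjecture`. -/
theorem residualConjecture_inconsistent : CryptoPremise → ¬ ResidualConjecture := residualAudit_holds.2.1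

/-- **Corollary**: the stage-3 residual implies the NEGATION of the route's premise — so `WbwEngine ⇐
ResidualConjectureClear` (stage 3) held only vacuously. -/
theorem not_cryptoPremise_of_residualConjectureClear (h : ResidualConjectureClear) : ¬ CryptoPremise :=
  fun hH => residualConjectureClear_inconsistent hH h

end Summit.QuantumAdvantage.QuantumAdvantage.Cruxes.WbwObfuscatedGluedTrees.KnowledgeOfWalkSplit.Generator.Residual

end
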